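import Mathlib
import Summits.Schanuel.Schanuel.Theses.PolarPhantoms

/-!
# Sketch — crux-ideate stmt-Schanuel-6845 (TraceZeroEstimate), ideator 2, round 1

First lemmas of the idea cards (statements only; `sorry` bodies). Nothing here is proposed to the gate.
-/

namespace Summit.Schanuel.Schanuel.Cruxes.TraceZeroEstimate.ApartmentUnion

open MvPolynomial

/-- `BoxSpans c I`: every polynomial is congruent mod `I` to one whose exponents are `≤ c`
componentwise, i.e. the box monomials span `R ⧸ I` (the zero-dimensional scheme `V(I)` imposes
independent conditions on the box linear system `𝒪(c)` of `(ℙ¹)^ι`). -/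
def BoxSpans {K : Type*} [Field K] {ι : Type*} (c : ι → ℕ) (I : Ideal (MvPolynomial ι K)) : Prop :=
  ∀ f : MvPolynomial ι K, ∃ g : MvPolynomial ι K, (∀ i, g.degreeOf i ≤ c i) ∧ f - g ∈ I

/-- Generation sublemma: if the box `c` spans mod `I`, then `I` is generated by its elements of
multidegree `≤ c + 1`. -/
theorem ideal_span_boxed_eq {K : Type*} [Field K] {ι : Type*} [Fintype ι] [DecidableEq ι]
    (c : ι → ℕ) (I : Ideal (MvPolynomial ι K)) (h : BoxSpans c I) :
    Ideal.span {t : MvPolynomial ι K | t ∈ I ∧ ∀ i, t.degreeOf i ≤ c i + 1} = I := by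
  sorry

/-- **First lemma (Lemma U, "apartment union").** Box-spanning is subadditive, with the loss of
one unit per variable, under intersection of ideals (= scheme-theoretic union of the zero loci):
if the box `c₁` spans mod `I₁` and the box `c₂` spans mod `I₂` then the box `c₁ + c₂ + 1` spans
mod `I₁ ⊓ I₂`.  Proof (5 lines): `f = f₁ + a`, `a ∈ I₁ = ⟨(I₁)_{≤ c₁+1}⟩` so `a = Σ uₗ tₗ`;
reduce `uₗ = vₗ + bₗ` mod `I₂` with `vₗ` in the box `c₂`; then `f ≡ f₁ + Σ vₗ tₗ` mod `I₁ ⊓ I₂`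
because `bₗ tₗ ∈ I₂ I₁ ⊆ I₁ ⊓ I₂`. -/
theorem boxSpans_inf {K : Type*} [Field K] {ι : Type*} [Fintype ι] [DecidableEq ι]
    (c₁ c₂ : ι → ℕ) (I₁ I₂ : Ideal (MvPolynomial ι K))
    (h₁ : BoxSpans c₁ I₁) (h₂ : BoxSpans c₂ I₂) :
    BoxSpans (fun i => c₁ i + c₂ i + 1) (I₁ ⊓ I₂) := by
  sorry

/-- Iterated form over a finite family (the `g = [F:ℚ]` conjugate "apartments"). -/
theorem boxSpans_iInf {K : Type*} [Field K] {ι : Type*} [Fintype ι] [DecidableEq ι]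
    {g : ℕ} (hg : 1 ≤ g) (c : ι → ℕ) (I : Fin g → Ideal (MvPolynomial ι K))
    (h : ∀ s, BoxSpans c (I s)) :
    BoxSpans (fun i => g * (c i + 1) - 1) (⨅ s, I s) := by
  sorry

end Summit.Schanuel.Schanuel.Cruxes.TraceZeroEstimate.ApartmentUnion

namespace Summit.Schanuel.Schanuel.Cruxes.TraceZeroEstimate

/-- The `g = 1` input (grounder g18-31's typed corollary of the PROVED
`Literature.NumberTheory.Transcendental.Philippon1986_GaGm_holds`, foreseen layer-2 child of the
route): Philippon's zero estimate read in Roy's box at ONE complex point. Restated here verbatim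
(not yet a tree declaration). -/
def RoyBoxZeroEstimate : Prop :=
  ∀ (n : ℕ) (y α : Fin n → ℂ), 1 ≤ n → LinearIndependent ℚ y → (∀ j, α j ≠ 0) →
    ∀ s₀ s₁ t₀ t₁ u : ℝ, Literature.NumberTheory.Transcendental.RoyAdmissible s₀ s₁ t₀ t₁ u →
    ∀ᶠ N : ℕ in Filter.atTop, ∀ P : MvPolynomial (Fin 2) ℂ, P ≠ 0 →
      (P.degreeOf 0 : ℝ) ≤ (N : ℝ) ^ t₀ → (P.degreeOf 1 : ℝ) ≤ (N : ℝ) ^ t₁ →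
      ∃ (k : ℕ) (m : Fin n → ℕ), (k : ℝ) ≤ (N : ℝ) ^ s₀ ∧ (∀ j, (m j : ℝ) ≤ (N : ℝ) ^ s₁) ∧
        MvPolynomial.aeval ![∑ j, ((m j : ℕ) : ℂ) * y j, ∏ j, α j ^ (m j)]
          ((fun Q : MvPolynomial (Fin 2) ℂ =>
            MvPolynomial.pderiv 0 Q + MvPolynomial.X 1 * MvPolynomial.pderiv 1 Q)^[k] P) ≠ 0

/-- **Transfer (card `apartment-union`).** The crux follows from the one-point zero estimate:
apply `RoyBoxZeroEstimate` at each of the `g` conjugate points `(σ ∘ y, σ ∘ α)` with the box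
shrunk by `2g` (admissibility is an open condition downward in `(s₀, s₁)`), translate each into
`BoxSpans` of the annihilator ideal `𝔞^σ ⊂ ℂ[T₁,…,Tₙ,∂]` of the `σ`-th jet functional,
unite by `boxSpans_iInf`, and read off `Σ_σ σB = 0` from the `m = 0` column. -/
theorem traceZeroEstimate_of_royBoxZeroEstimate (h : RoyBoxZeroEstimate) :
    Summit.Schanuel.Schanuel.Theses.PolarPhantoms.TraceZeroEstimate := by
  sorry

/-- The dictionary behind the transfer, stated at one conjugate: the `ℂ[T₁,…,Tₙ,∂]`-module
structure on `ℂ[X₀,X₁]` given by the commuting operators `T_j ↦ (X₀ ↦ X₀ + y_j, X₁ ↦ α_j X₁)` and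
`∂ ↦ D = ∂₀ + X₁∂₁`; the functional attached to `f = Σ f_(m,k) T^m ∂^k` is
`C ↦ Σ f_(m,k) (D^k C)(m·y, α^m)`. Its kernel on the degree box is the "apartment" ideal `𝔞`. -/
noncomputable def jetFunctional {n : ℕ} (y α : Fin n → ℂ) (f : MvPolynomial (Fin (n + 1)) ℂ)
    (C : MvPolynomial (Fin 2) ℂ) : ℂ :=
  f.support.sum fun e =>
    f.coeff e *
      MvPolynomial.aeval ![∑ j, ((e (Fin.castSucc j) : ℕ) : ℂ) * y j, ∏ j, α j ^ (e (Fin.castSucc j))]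
        ((fun Q : MvPolynomial (Fin 2) ℂ =>
            MvPolynomial.pderiv 0 Q + MvPolynomial.X 1 * MvPolynomial.pderiv 1 Q)^[e (Fin.last n)] C)

/-- The apartment of a point: polynomials in `(T, ∂)` whose jet functional kills the degree box. -/
def apartment {n : ℕ} (y α : Fin n → ℂ) (D₀ D₁ : ℕ) : Set (MvPolynomial (Fin (n + 1)) ℂ) :=
  {f | ∀ C : MvPolynomial (Fin 2) ℂ, C.degreeOf 0 ≤ D₀ → C.degreeOf 1 ≤ D₁ → jetFunctional y α f C = 0}

/-- Dictionary lemma 1: the apartment is an ideal (because `D` and the translations commute and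
preserve the degree box, `jetFunctional y α (T^m ∂^k * f) C = jetFunctional y α f (D^k τ^m C)`). -/
theorem apartment_isIdeal {n : ℕ} (y α : Fin n → ℂ) (D₀ D₁ : ℕ) :
    ∃ I : Ideal (MvPolynomial (Fin (n + 1)) ℂ), (I : Set (MvPolynomial (Fin (n + 1)) ℂ)) = apartment y α D₀ D₁ := by
  sorry

/-- Dictionary lemma 2 (one point): the `g = 1` zero estimate in the box `(M,…,M,K)` is exactly
`BoxSpans (M,…,M,K)` for the apartment ideal. -/
theorem boxSpans_apartment_iff {n : ℕ} (y α : Fin n → ℂ) (D₀ D₁ M K : ℕ)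
    (I : Ideal (MvPolynomial (Fin (n + 1)) ℂ))
    (hI : (I : Set (MvPolynomial (Fin (n + 1)) ℂ)) = apartment y α D₀ D₁) :
    ApartmentUnion.BoxSpans (Fin.snoc (fun _ : Fin n => M) K) I ↔
      ∀ C : MvPolynomial (Fin 2) ℂ, C.degreeOf 0 ≤ D₀ → C.degreeOf 1 ≤ D₁ →
        (∀ (k : ℕ) (m : Fin n → ℕ), k ≤ K → (∀ j, m j ≤ M) →
          MvPolynomial.aeval ![∑ j, ((m j : ℕ) : ℂ) * y j, ∏ j, α j ^ (m j)]
            ((fun Q : MvPolynomial (Fin 2) ℂ =>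
              MvPolynomial.pderiv 0 Q + MvPolynomial.X 1 * MvPolynomial.pderiv 1 Q)^[k] C) = 0) →
        C = 0 := by
  sorry

end Summit.Schanuel.Schanuel.Cruxes.TraceZeroEstimate
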